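import Literature.MathematicalPhysics.QuantumLattice.LiebWuResolventMonotone
import Literature.MathematicalPhysics.QuantumLattice.LiebWuFiniteBFixedPoint
import HarnessLib

/-!
# Lieb–Wu 2003, Lemma 2: the momentum density grows with the range `B` (the operator `Û_B`)

Family `hubbard`. Lieb–Wu, Physica A 321 (2003) 1, §5, **Lemma 2 (Monotonicity in B):** "When `B`
increases with `Q` fixed, `f(x)` increases pointwise for all `x ∈ ℝ`. This implies, in particular, that
`ρ(k)` increases for all `|k| ≤ π/2` and decreases for all `π/2 ≤ |k| ≤ π`." Printed proof: with
`V̂ = (1 + K̂²B̂)⁻¹` and `Û = K̂B̂V̂K̂` (eq. (U)), the key identity (keyequation)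
`K̂²(1 + K̂²)⁻¹g = Ûg + K̂(1 + K̂²)⁻¹(1 - B̂)S` (`S = V̂K̂g`) shows that "the integral kernel of `Û`, in contrast
to that of `V̂`, is a pointwise INCREASING function of `B`", and then `f = (1 + ÛD̂)t + ÛÂf` (fiterate1)
"tells us that `f` is also pointwise monotone".

In the tree's variables `f - t = G := K ∗ (1_S σ_S)` (`ρ_S(k) = 1/2π + cos k · G_S(sin k)`), and the range is
an arbitrary measurable `S` (`B̂ = 1_S`). With the resolvent `V_S` of `LiebWuResolventSeries` /
`LiebWuResolventMonotone` this file proves: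

* `liebWuPhi U S ζ = K ∗ (1_S · V_S ζ)` — the operator `K̂B̂V̂` (so `Ûg = liebWuPhi (R̂g)`, `R̂ = ½ r ∗ ·`);
* `liebWuPhi_add_tail`: **(keyequation)** `K ∗ (1_S V_S ζ) + ½ r ∗ (1_{Sᶜ} V_S ζ) = K ∗ ζ`;
* `liebWuPhi_mono_set`: `S ⊆ S'` ⇒ `liebWuPhi U S ζ ≤ liebWuPhi U S' ζ` (kernel of `Û` increasing in `B`),
  `liebWuPhi_le`: `≤ K ∗ ζ`, additivity and monotonicity in `ζ`;
* `liebWuG_eq`: (fiterate1) `G_S = Φ_S ξ + Φ_S(R̂(ÂG_S))`, from `σ_S = V_S(ξ + R̂ÂK̂B̂σ_S)` (uniqueness of the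
  resolvent fixed point applied to the Neumann solution `σ_S`);
* **`liebWuG_mono_set`** (Lemma 2): `S ⊆ S'` ⇒ `G_S ≤ G_{S'}` pointwise on `ℝ` — proved from (fiterate1) by a
  positivity argument (`(G_S - G_{S'})⁺ ≤ u ∗ (G_S - G_{S'})⁺`, `∫u = ½`), in place of the printed series
  `[1 + ÛÂ + (ÛÂ)² + ⋯]`.

The consequences for `ρ`, `N/N_a` and `M/N` (the rest of Theorem 2 / PRL statement (b)) are drawn in
`LiebWuMagnetizationMonotone`. No named fact.

## References

* E. H. Lieb, F. Y. Wu, Physica A 321 (2003) 1–27 = arXiv:cond-mat/0207529, §5, Lemma 2, eqs. (general),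
  (keyequation), (U), (fiterate1), (fiterate2) (key `LiebWuPhysicaA2003`).
-/

noncomputable section

open MeasureTheory Set Real Filter intervalIntegral
open Literature.Analysis.SpecialFunctions Literature.MeasureTheory.Lebesgue
open scoped Convolution Topology

namespace Literature.MathematicalPhysics.QuantumLattice

namespace LiebWuLemma2

variable {f g k : ℝ → ℝ} {B B' : ℝ}

/-- `t ↦ f(t) g(x - t)` is integrable for `f ∈ L¹`, `g` bounded continuous. [folklore] -/
private theorem integrable_mul_sub₈ (hf : Integrable f) (hgc : Continuous g) (hgB : ∀ y, |g y| ≤ B)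
    (x : ℝ) : Integrable fun t => f t * g (x - t) :=
  hf.mul_bdd (hgc.comp (continuous_const.sub continuous_id)).aestronglyMeasurable
    (Eventually.of_forall fun t => by rw [Real.norm_eq_abs]; exact hgB _)

/-- `x ↦ ∫ f(t) g(x - t) dt` is continuous for `f ∈ L¹`, `g` bounded continuous. [folklore] -/
private theorem continuous_conv₈ (hf : Integrable f) (hgc : Continuous g) (hgB : ∀ y, |g y| ≤ B) :
    Continuous fun x => ∫ t, f t * g (x - t) := by
  have h : (fun x => ∫ t, f t * g (x - t)) = f ⋆[ContinuousLinearMap.mul ℝ ℝ, volume] g := by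
    funext x; rw [convolution_def]; simp only [ContinuousLinearMap.mul_apply']
  rw [h]
  refine BddAbove.continuous_convolution_right_of_integrable (L := ContinuousLinearMap.mul ℝ ℝ)
    ⟨B, ?_⟩ hf hgc
  rintro _ ⟨y, rfl⟩
  exact (Real.norm_eq_abs _).trans_le (hgB y)

/-- `∫∫ f(t) g(x - t) dt dx = (∫ f)(∫ g)`, and the convolution is integrable. [folklore] -/
private theorem integrable_conv_and_integral₈ (hf : Integrable f) (hg : Integrable g) :
    Integrable (fun x => ∫ t, f t * g (x - t)) ∧ ∫ x, ∫ t, f t * g (x - t) = (∫ t, f t) * ∫ y, g y := by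
  have h : (fun x => ∫ t, f t * g (x - t)) = f ⋆[ContinuousLinearMap.mul ℝ ℝ, volume] g := by
    funext x; rw [convolution_def]; simp only [ContinuousLinearMap.mul_apply']
  rw [h]
  exact ⟨hf.integrable_convolution _ hg, by rw [integral_convolution (L := ContinuousLinearMap.mul ℝ ℝ) hf hg]; rfl⟩

/-- `0 ≤ ∫ f(t) g(x - t) dt ≤ B ∫ f` for `f, g ≥ 0`, `g ≤ B`. [folklore] -/
private theorem conv_nonneg_le₈ (hf : Integrable f) (hf0 : ∀ t, 0 ≤ f t) (hg0 : ∀ y, 0 ≤ g y)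
    (hgB : ∀ y, g y ≤ B) (x : ℝ) : 0 ≤ ∫ t, f t * g (x - t) ∧ ∫ t, f t * g (x - t) ≤ B * ∫ t, f t := by
  refine ⟨integral_nonneg fun t => mul_nonneg (hf0 t) (hg0 _), ?_⟩
  rw [← MeasureTheory.integral_const_mul]
  refine integral_mono_of_nonneg (Eventually.of_forall fun t => mul_nonneg (hf0 t) (hg0 _))
    (hf.const_mul B) (Eventually.of_forall fun t => ?_)
  dsimp only
  rw [mul_comm B]
  exact mul_le_mul_of_nonneg_left (hgB _) (hf0 t)

/-- Associativity `((f ∗ g) ∗ k)(x) = (f ∗ (g ∗ k))(x)`. [folklore] -/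
private theorem conv_conv₈ (hf : Integrable f) (hgi : Integrable g) (hkc : Continuous k)
    (hkB : ∀ y, |k y| ≤ B') (x : ℝ) :
    ∫ y, (∫ z, f z * g (y - z)) * k (x - y) = ∫ z, f z * ∫ s, g s * k (x - z - s) := by
  have hprod : Integrable (fun p : ℝ × ℝ => f p.2 * g (p.1 - p.2)) ((volume : Measure ℝ).prod volume) :=
    hf.convolution_integrand (ContinuousLinearMap.mul ℝ ℝ) hgi
  have hkm : Continuous fun p : ℝ × ℝ => k (x - p.1) := hkc.comp (continuous_const.sub continuous_fst)
  have hF : Integrable (Function.uncurry fun y z => f z * g (y - z) * k (x - y)) ((volume : Measure ℝ).prod volume) :=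
    hprod.mul_bdd (c := B') hkm.aestronglyMeasurable (Eventually.of_forall fun p => by rw [Real.norm_eq_abs]; exact hkB _)
  calc ∫ y, (∫ z, f z * g (y - z)) * k (x - y) = ∫ y, ∫ z, f z * g (y - z) * k (x - y) := by
        refine MeasureTheory.integral_congr_ae (Eventually.of_forall fun y => ?_)
        exact (MeasureTheory.integral_mul_const (k (x - y)) _).symm
    _ = ∫ z, ∫ y, f z * g (y - z) * k (x - y) := integral_integral_swap hF
    _ = ∫ z, f z * ∫ s, g s * k (x - z - s) := by
        refine MeasureTheory.integral_congr_ae (Eventually.of_forall fun z => ?_)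
        dsimp only
        rw [← MeasureTheory.integral_const_mul, ← integral_add_right_eq_self (fun y => f z * g (y - z) * k (x - y)) z]
        refine MeasureTheory.integral_congr_ae (Eventually.of_forall fun s => ?_)
        dsimp only
        rw [add_sub_cancel_right, show x - (s + z) = x - z - s by ring]
        ring

end LiebWuLemma2

open LiebWuLemma2

/-- The operator **`K̂B̂V̂`** (so that `Û = K̂B̂V̂K̂` of eq. (U) is `g ↦ liebWuPhi U S (R̂g)`):
`Φ_S ζ (x) = ∫ 1_S(t) (V_S ζ)(t) K_{U/4}(x - t) dt`. [cite: LiebWuPhysicaA2003, §5, eq. (U)] -/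
def liebWuPhi (U : ℝ) (S : Set ℝ) (ζ : ℝ → ℝ) (x : ℝ) : ℝ :=
  ∫ t, S.indicator (liebWuResolvent U S ζ) t * cauchyDensity (U / 4) (x - t)

/-- `G_S := K ∗ (1_S σ_S)`, the interaction part of the momentum density: `ρ_S(k) = 1/2π + cos k · G_S(sin k)`
(Lieb–Wu's `f - t = K̂B̂σ`, eq. (feqn)). [cite: LiebWuPhysicaA2003, §5, eq. (feqn)] -/
def liebWuG (U Q : ℝ) (S : Set ℝ) (x : ℝ) : ℝ :=
  ∫ t, S.indicator (liebWuSigmaAtS U Q S) t * cauchyDensity (U / 4) (x - t)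

variable {U Q : ℝ} {S S' : Set ℝ} {ζ ζ₁ ζ₂ : ℝ → ℝ} {M M₁ M₂ : ℝ}

section Phi

/-- **(keyequation): `K ∗ (1_S V_S ζ) + ½ r ∗ (1_{Sᶜ} V_S ζ) = K ∗ ζ`** (convolve `V = ζ + u ∗ 1_{Sᶜ}V` with `K`
and use `u ∗ K = K - r/2`). [cite: LiebWuPhysicaA2003, §5, eq. (keyequation)] -/
theorem liebWuPhi_add_tail (hU : 0 < U) (hS : MeasurableSet S) (hζc : Continuous ζ) (hζ0 : ∀ x, 0 ≤ ζ x)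
    (hζi : Integrable ζ) (hζM : ∀ x, ζ x ≤ M) (x : ℝ) :
    liebWuPhi U S ζ x + 1 / 2 * ∫ t, Sᶜ.indicator (liebWuResolvent U S ζ) t * sechKernel (U / 4) (x - t) =
      ∫ t, ζ t * cauchyDensity (U / 4) (x - t) := by
  have hc : 0 < U / 4 := by positivity
  have hKc : Continuous (cauchyDensity (U / 4)) := continuous_cauchyDensity hc
  have hKB : ∀ y, |cauchyDensity (U / 4) y| ≤ 1 / (π * (U / 4)) := fun y => by
    rw [abs_of_pos (cauchyDensity_pos hc y)]; exact cauchyDensity_le hc y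
  have hrc : Continuous (sechKernel (U / 4)) := continuous_sechKernel hc
  have hrB : ∀ y, |sechKernel (U / 4) y| ≤ 1 / (2 * (U / 4)) := fun y => by
    rw [abs_of_pos (sechKernel_pos hc y)]; exact sechKernel_le hc y
  have hui : Integrable (fermiKernel (U / 4)) := integrable_fermiKernel hc
  set V := liebWuResolvent U S ζ with hV
  have hVi : Integrable V := integrable_liebWuResolvent hU hS hζc hζ0 hζi hζM
  have hVSi : Integrable (S.indicator V) := hVi.indicator hS
  have hVCi : Integrable (Sᶜ.indicator V) := hVi.indicator hS.compl
  have hVeq : ∀ t, V t = ζ t + liebWuT U S V t := liebWuResolvent_eq hU hS hζc hζ0 hζi hζM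
  -- `K ∗ V = K ∗ ζ + (u ∗ 1_{Sᶜ}V) ∗ K = K ∗ ζ + 1_{Sᶜ}V ∗ (K - r/2)`
  have hTK : ∫ t, liebWuT U S V t * cauchyDensity (U / 4) (x - t) =
      (∫ t, Sᶜ.indicator V t * cauchyDensity (U / 4) (x - t)) -
        1 / 2 * ∫ t, Sᶜ.indicator V t * sechKernel (U / 4) (x - t) := by
    simp only [liebWuT]
    rw [conv_conv₈ hVCi hui hKc hKB]
    have hin : ∀ z, ∫ s, fermiKernel (U / 4) s * cauchyDensity (U / 4) (x - z - s) =
        cauchyDensity (U / 4) (x - z) - sechKernel (U / 4) (x - z) / 2 := fun z =>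
      integral_fermiKernel_mul_cauchyDensity hc (x - z)
    simp_rw [hin]
    have h1 : (fun z => Sᶜ.indicator V z * (cauchyDensity (U / 4) (x - z) - sechKernel (U / 4) (x - z) / 2)) =
        fun z => Sᶜ.indicator V z * cauchyDensity (U / 4) (x - z) - 1 / 2 * (Sᶜ.indicator V z * sechKernel (U / 4) (x - z)) := by
      funext z; ring
    rw [h1, integral_sub (integrable_mul_sub₈ hVCi hKc hKB x) ((integrable_mul_sub₈ hVCi hrc hrB x).const_mul _),
      MeasureTheory.integral_const_mul]
  have hsplit : ∫ t, V t * cauchyDensity (U / 4) (x - t) =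
      (∫ t, S.indicator V t * cauchyDensity (U / 4) (x - t)) + ∫ t, Sᶜ.indicator V t * cauchyDensity (U / 4) (x - t) := by
    rw [← integral_add (integrable_mul_sub₈ hVSi hKc hKB x) (integrable_mul_sub₈ hVCi hKc hKB x)]
    refine MeasureTheory.integral_congr_ae (Eventually.of_forall fun t => ?_)
    beta_reduce
    by_cases ht : t ∈ S
    · rw [indicator_of_mem ht, indicator_of_notMem (show t ∉ Sᶜ from fun h' => h' ht)]; ring
    · rw [indicator_of_notMem ht, indicator_of_mem (mem_compl ht)]; ring
  have hKV : ∫ t, V t * cauchyDensity (U / 4) (x - t) =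
      (∫ t, ζ t * cauchyDensity (U / 4) (x - t)) + ∫ t, liebWuT U S V t * cauchyDensity (U / 4) (x - t) := by
    rw [← integral_add (integrable_mul_sub₈ hζi hKc hKB x)
      (integrable_mul_sub₈ (liebWuT_props hU hS hVi fun t => (hζ0 t).trans
        (le_liebWuResolvent hU hS hζc hζ0 hζi hζM t)).2.2.1 hKc hKB x)]
    refine MeasureTheory.integral_congr_ae (Eventually.of_forall fun t => ?_)
    beta_reduce
    rw [hVeq t]; ring
  rw [liebWuPhi]
  linarith [hTK, hsplit, hKV]

/-- Basic properties of `Φ_S ζ`: continuous, `0 ≤ Φ_S ζ ≤ K ∗ ζ`, integrable.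
[cite: LiebWuPhysicaA2003, §5, eq. (keyequation)] -/
theorem liebWuPhi_props (hU : 0 < U) (hS : MeasurableSet S) (hζc : Continuous ζ) (hζ0 : ∀ x, 0 ≤ ζ x)
    (hζi : Integrable ζ) (hζM : ∀ x, ζ x ≤ M) :
    Continuous (liebWuPhi U S ζ) ∧ (∀ x, 0 ≤ liebWuPhi U S ζ x) ∧
      (∀ x, liebWuPhi U S ζ x ≤ ∫ t, ζ t * cauchyDensity (U / 4) (x - t)) ∧ Integrable (liebWuPhi U S ζ) := by
  have hc : 0 < U / 4 := by positivity
  have hKB : ∀ y, |cauchyDensity (U / 4) y| ≤ 1 / (π * (U / 4)) := fun y => by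
    rw [abs_of_pos (cauchyDensity_pos hc y)]; exact cauchyDensity_le hc y
  have hVi : Integrable (liebWuResolvent U S ζ) := integrable_liebWuResolvent hU hS hζc hζ0 hζi hζM
  have hV0 : ∀ t, 0 ≤ liebWuResolvent U S ζ t := fun t => (hζ0 t).trans (le_liebWuResolvent hU hS hζc hζ0 hζi hζM t)
  have hVSi : Integrable (S.indicator (liebWuResolvent U S ζ)) := hVi.indicator hS
  have hVS0 : ∀ t, 0 ≤ S.indicator (liebWuResolvent U S ζ) t := fun t => indicator_nonneg (fun s _ => hV0 s) _
  have hVC0 : ∀ t, 0 ≤ Sᶜ.indicator (liebWuResolvent U S ζ) t := fun t => indicator_nonneg (fun s _ => hV0 s) _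
  refine ⟨continuous_conv₈ hVSi (continuous_cauchyDensity hc) hKB,
    fun x => (conv_nonneg_le₈ hVSi hVS0 (fun y => (cauchyDensity_pos hc y).le) (cauchyDensity_le hc) x).1,
    fun x => ?_, (integrable_conv_and_integral₈ hVSi (integrable_cauchyDensity hc.le)).1⟩
  have htail : 0 ≤ 1 / 2 * ∫ t, Sᶜ.indicator (liebWuResolvent U S ζ) t * sechKernel (U / 4) (x - t) :=
    mul_nonneg (by norm_num) (integral_nonneg fun t => mul_nonneg (hVC0 t) (sechKernel_pos hc _).le)
  linarith [liebWuPhi_add_tail hU hS hζc hζ0 hζi hζM x]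

/-- **The kernel of `Û` increases with `B`:** `S ⊆ S'` ⇒ `Φ_S ζ ≤ Φ_{S'} ζ` for `ζ ≥ 0` (by (keyequation): the
left side `K ∗ ζ` is independent of `S` and the tail term decreases).
[cite: LiebWuPhysicaA2003, §5, Lemma 2 (monotonicity of Û)] -/
theorem liebWuPhi_mono_set (hU : 0 < U) (hS : MeasurableSet S) (hS' : MeasurableSet S') (hSS' : S ⊆ S')
    (hζc : Continuous ζ) (hζ0 : ∀ x, 0 ≤ ζ x) (hζi : Integrable ζ) (hζM : ∀ x, ζ x ≤ M) (x : ℝ) :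
    liebWuPhi U S ζ x ≤ liebWuPhi U S' ζ x := by
  have hc : 0 < U / 4 := by positivity
  have hrc : Continuous (sechKernel (U / 4)) := continuous_sechKernel hc
  have hrB : ∀ y, |sechKernel (U / 4) y| ≤ 1 / (2 * (U / 4)) := fun y => by
    rw [abs_of_pos (sechKernel_pos hc y)]; exact sechKernel_le hc y
  have hV0 : ∀ t, 0 ≤ liebWuResolvent U S' ζ t := fun t => (hζ0 t).trans (le_liebWuResolvent hU hS' hζc hζ0 hζi hζM t)
  have hle : ∀ t, S'ᶜ.indicator (liebWuResolvent U S' ζ) t ≤ Sᶜ.indicator (liebWuResolvent U S ζ) t := by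
    intro t
    by_cases ht : t ∈ S'ᶜ
    · rw [indicator_of_mem ht, indicator_of_mem (compl_subset_compl.2 hSS' ht)]
      exact liebWuResolvent_antitone_set hU hS hS' hSS' hζc hζ0 hζi hζM t
    · rw [indicator_of_notMem ht]
      exact indicator_nonneg (fun s _ => (hζ0 s).trans (le_liebWuResolvent hU hS hζc hζ0 hζi hζM s)) _
  have hmono : ∫ t, S'ᶜ.indicator (liebWuResolvent U S' ζ) t * sechKernel (U / 4) (x - t) ≤
      ∫ t, Sᶜ.indicator (liebWuResolvent U S ζ) t * sechKernel (U / 4) (x - t) :=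
    integral_mono (integrable_mul_sub₈ ((integrable_liebWuResolvent hU hS' hζc hζ0 hζi hζM).indicator hS'.compl) hrc hrB x)
      (integrable_mul_sub₈ ((integrable_liebWuResolvent hU hS hζc hζ0 hζi hζM).indicator hS.compl) hrc hrB x)
      fun t => mul_le_mul_of_nonneg_right (hle t) (sechKernel_pos hc _).le
  linarith [liebWuPhi_add_tail hU hS hζc hζ0 hζi hζM x, liebWuPhi_add_tail hU hS' hζc hζ0 hζi hζM x]

/-- `Φ_S` is additive in the source. [cite: LiebWuPhysicaA2003, §5, eq. (U)] -/
theorem liebWuPhi_add (hU : 0 < U) (hS : MeasurableSet S) (h₁c : Continuous ζ₁) (h₁0 : ∀ x, 0 ≤ ζ₁ x)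
    (h₁i : Integrable ζ₁) (h₁M : ∀ x, ζ₁ x ≤ M₁) (h₂c : Continuous ζ₂) (h₂0 : ∀ x, 0 ≤ ζ₂ x) (h₂i : Integrable ζ₂)
    (h₂M : ∀ x, ζ₂ x ≤ M₂) (x : ℝ) :
    liebWuPhi U S (fun t => ζ₁ t + ζ₂ t) x = liebWuPhi U S ζ₁ x + liebWuPhi U S ζ₂ x := by
  have hc : 0 < U / 4 := by positivity
  have hKc : Continuous (cauchyDensity (U / 4)) := continuous_cauchyDensity hc
  have hKB : ∀ y, |cauchyDensity (U / 4) y| ≤ 1 / (π * (U / 4)) := fun y => by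
    rw [abs_of_pos (cauchyDensity_pos hc y)]; exact cauchyDensity_le hc y
  rw [liebWuPhi, liebWuPhi, liebWuPhi, ← integral_add
    (integrable_mul_sub₈ ((integrable_liebWuResolvent hU hS h₁c h₁0 h₁i h₁M).indicator hS) hKc hKB x)
    (integrable_mul_sub₈ ((integrable_liebWuResolvent hU hS h₂c h₂0 h₂i h₂M).indicator hS) hKc hKB x)]
  refine MeasureTheory.integral_congr_ae (Eventually.of_forall fun t => ?_)
  beta_reduce
  by_cases ht : t ∈ S
  · simp only [indicator_of_mem ht]
    rw [liebWuResolvent_add hU hS h₁c h₁0 h₁i h₁M h₂c h₂0 h₂i h₂M t]; ring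
  · simp only [indicator_of_notMem ht]; ring

/-- `Φ_S` is monotone in the source. [cite: LiebWuPhysicaA2003, §5, eq. (U)] -/
theorem liebWuPhi_mono (hU : 0 < U) (hS : MeasurableSet S) (h₁c : Continuous ζ₁) (h₁0 : ∀ x, 0 ≤ ζ₁ x)
    (h₁i : Integrable ζ₁) (h₁M : ∀ x, ζ₁ x ≤ M₁) (h₂c : Continuous ζ₂) (h₂0 : ∀ x, 0 ≤ ζ₂ x) (h₂i : Integrable ζ₂)
    (h₂M : ∀ x, ζ₂ x ≤ M₂) (hle : ∀ x, ζ₁ x ≤ ζ₂ x) (x : ℝ) : liebWuPhi U S ζ₁ x ≤ liebWuPhi U S ζ₂ x := by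
  have hc : 0 < U / 4 := by positivity
  have hKc : Continuous (cauchyDensity (U / 4)) := continuous_cauchyDensity hc
  have hKB : ∀ y, |cauchyDensity (U / 4) y| ≤ 1 / (π * (U / 4)) := fun y => by
    rw [abs_of_pos (cauchyDensity_pos hc y)]; exact cauchyDensity_le hc y
  refine integral_mono (integrable_mul_sub₈ ((integrable_liebWuResolvent hU hS h₁c h₁0 h₁i h₁M).indicator hS) hKc hKB x)
    (integrable_mul_sub₈ ((integrable_liebWuResolvent hU hS h₂c h₂0 h₂i h₂M).indicator hS) hKc hKB x) fun t => ?_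
  exact mul_le_mul_of_nonneg_right (indicator_le_indicator' fun _ =>
    liebWuResolvent_mono hU hS h₁c h₁0 h₁i h₁M h₂c h₂0 h₂i h₂M hle t) (cauchyDensity_pos hc _).le

end Phi

end Literature.MathematicalPhysics.QuantumLattice

end
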